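import Mathlib

/-!
# LEMMA G2 (mine-3, proofs/MINE3-GLUING.md §3): the C-028 threshold is sub-multiplicative (p6, gen 15)

For `x, y ∈ [0, 1]` put `Φ(x, y) := (xy − √(xy(1−x)(1−y)))/(x + y − xy)`.  LEMMA G2:
`Φ(xx', yy') ≤ Φ⁺(x, y)·Φ⁺(x', y')` for all `x, y, x', y' ∈ [0, 1]` (`Φ⁺ = max Φ 0`).  The proof is
mine-3's: with `u = √((1−x)(1−y))`, `v = √(xy)` (so `u + v ≤ 1`) one has `Φ = v(v − u)/(1 − u²)`; the
product has `v'' = vv'` and `u''² = (1−xx')(1−yy') ≥ (u + vu')²` (one AM–GM, `g2_amgm`); `φ(V, ·)` is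
non-increasing (`g2_mono`); and the polynomial inequality G2′
`(vv' − w)(1−u²)(1−u'²) ≤ (v−u)(v'−u')(1−w²)`, `w = u + vu'` (`g2_poly`), follows from an exact identity
(`g2_identity`) whose right side is affine in `d = v' − u'` and nonnegative at both ends of
`[0, 1 − 2u']` (concavity in `u'`).  The degenerate denominators (`x = y = 0`, `u'' = 1`) are Lean's
`0/0 = 0`, harmless because the right side is nonnegative.
-/

namespace PercRepro

/-- `Φ(x, y) = (xy − √(xy(1−x)(1−y))) / (x + y − xy)`: the C-028(c) threshold in the coordinates
`x = Z/Ma`, `y = Z/Mb` (mine-3). -/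
noncomputable def c028Phi (x y : ℝ) : ℝ :=
  (x * y - Real.sqrt (x * y * (1 - x) * (1 - y))) / (x + y - x * y)

section Core

/-! ### The real-variable core -/

/-- **Step 4, the identity.** -/
theorem g2_identity (u v u' v' : ℝ) :
    (v - u) * (v' - u') * (1 - (u + v * u') ^ 2) -
        (v * v' - (u + v * u')) * (1 - u ^ 2) * (1 - u' ^ 2) =
      u * (1 - u ^ 2) * (1 - u' ^ 2) * (1 - (v' - u')) +
        (v' - u') * (v - u) * (u' ^ 2 * (1 - u ^ 2 - v ^ 2) - 2 * u * v * u') := by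
  ring

/-- **Step 4, the sign.** On `0 ≤ u ≤ v ≤ 1 − u`, `0 ≤ u' ≤ v' ≤ 1 − u'`, the right side of the identity
is nonnegative: it is affine in `d = v' − u' ∈ [0, 1 − 2u']`, nonnegative at `d = 0`, and at
`d = 1 − 2u'` equals `u'·g(u')` with `g` concave on `[0, ½]` and nonnegative at `0` and `½`. -/
theorem g2_rhs_nonneg {u v u' v' : ℝ} (hu : 0 ≤ u) (huv : u ≤ v) (hsum : u + v ≤ 1)
    (hu' : 0 ≤ u') (huv' : u' ≤ v') (hsum' : u' + v' ≤ 1) :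
    0 ≤ u * (1 - u ^ 2) * (1 - u' ^ 2) * (1 - (v' - u')) +
        (v' - u') * (v - u) * (u' ^ 2 * (1 - u ^ 2 - v ^ 2) - 2 * u * v * u') := by
  have hv : 0 ≤ v := le_trans hu huv
  have h1 : 0 ≤ 1 - u ^ 2 - v ^ 2 := by nlinarith
  have hu1 : 0 ≤ 1 - u ^ 2 := by nlinarith
  have hu'1 : 0 ≤ 1 - u' ^ 2 := by nlinarith
  have hd0 : 0 ≤ v' - u' := by linarith
  have hd1 : v' - u' ≤ 1 - 2 * u' := by linarith
  have hu'half : u' ≤ 1 / 2 := by linarith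
  -- g(U) := 2u(1−u²)(1−U²) + (1−2U)(v−u)(U(1−u²−v²) − 2uv); g(0) ≥ 0, g(½) ≥ 0, g concave on [0, ½]
  have hg0 : 0 ≤ 2 * u * (1 - u ^ 2 - v ^ 2 + u * v) := by
    have : 0 ≤ 1 - u ^ 2 - v ^ 2 + u * v := by nlinarith [mul_nonneg hu hv]
    exact mul_nonneg (by linarith) this
  have hghalf : 0 ≤ 3 / 2 * u * (1 - u ^ 2) := by
    have := mul_nonneg hu hu1
    linarith
  -- concavity: the U² coefficient is −(2u(1−u²) + 2(v−u)(1−u²−v²)) ≤ 0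
  have hα : 0 ≤ 2 * u * (1 - u ^ 2) + 2 * (v - u) * (1 - u ^ 2 - v ^ 2) := by
    have h2 := mul_nonneg (sub_nonneg.2 huv) h1
    have h3 := mul_nonneg hu hu1
    linarith
  -- g(u') ≥ (1 − 2u') g(0) + 2u' g(½)
  have hg : 0 ≤ 2 * u * (1 - u ^ 2) * (1 - u' ^ 2) +
      (1 - 2 * u') * (v - u) * (u' * (1 - u ^ 2 - v ^ 2) - 2 * u * v) := by
    have hinterp : 2 * u * (1 - u ^ 2) * (1 - u' ^ 2) +
        (1 - 2 * u') * (v - u) * (u' * (1 - u ^ 2 - v ^ 2) - 2 * u * v) =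
        (1 - 2 * u') * (2 * u * (1 - u ^ 2 - v ^ 2 + u * v)) +
          2 * u' * (3 / 2 * u * (1 - u ^ 2)) +
          u' * (1 / 2 - u') * (2 * u * (1 - u ^ 2) + 2 * (v - u) * (1 - u ^ 2 - v ^ 2)) := by
      ring
    rw [hinterp]
    have h12 : 0 ≤ 1 - 2 * u' := by linarith
    have h13 : 0 ≤ 1 / 2 - u' := by linarith
    have := mul_nonneg (mul_nonneg hu' h13) hα
    have := mul_nonneg h12 hg0
    have := mul_nonneg (mul_nonneg (by norm_num : (0:ℝ) ≤ 2) hu') hghalf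
    nlinarith
  -- E(d) is affine in d; E(0) = u(1−u²)(1−u'²) ≥ 0; E(1 − 2u') = u' g(u') ≥ 0
  have hE0 : 0 ≤ u * (1 - u ^ 2) * (1 - u' ^ 2) := mul_nonneg (mul_nonneg hu hu1) hu'1
  have hE1 : 0 ≤ u' * (2 * u * (1 - u ^ 2) * (1 - u' ^ 2) +
      (1 - 2 * u') * (v - u) * (u' * (1 - u ^ 2 - v ^ 2) - 2 * u * v)) := mul_nonneg hu' hg
  -- the affine interpolation in d := v' − u' on [0, 1 − 2u'] (the slope is the difference quotient)
  by_cases hcase : 1 - 2 * u' = 0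
  · -- then d = 0 and u' = ½
    have hd : v' - u' = 0 := by linarith
    rw [hd]
    simp only [sub_zero, mul_one, zero_mul, add_zero]
    exact hE0
  · have hpos : 0 < 1 - 2 * u' := lt_of_le_of_ne (by linarith) (Ne.symm hcase)
    -- (1 − 2u')·E(d) = (1 − 2u' − d)·E(0) + d·E(1 − 2u'), an identity of polynomials
    have key : (1 - 2 * u') * (u * (1 - u ^ 2) * (1 - u' ^ 2) * (1 - (v' - u')) +
        (v' - u') * (v - u) * (u' ^ 2 * (1 - u ^ 2 - v ^ 2) - 2 * u * v * u')) =
        (1 - 2 * u' - (v' - u')) * (u * (1 - u ^ 2) * (1 - u' ^ 2)) +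
          (v' - u') * (u' * (2 * u * (1 - u ^ 2) * (1 - u' ^ 2) +
            (1 - 2 * u') * (v - u) * (u' * (1 - u ^ 2 - v ^ 2) - 2 * u * v))) := by
      ring
    have hmul : 0 ≤ (1 - 2 * u') * (u * (1 - u ^ 2) * (1 - u' ^ 2) * (1 - (v' - u')) +
        (v' - u') * (v - u) * (u' ^ 2 * (1 - u ^ 2 - v ^ 2) - 2 * u * v * u')) := by
      rw [key]
      exact add_nonneg (mul_nonneg (by linarith) hE0) (mul_nonneg hd0 hE1)
    exact (mul_nonneg_iff_of_pos_left hpos).1 hmul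

/-- **G2′, the polynomial inequality** (Step 4): `(vv' − w)(1−u²)(1−u'²) ≤ (v−u)(v'−u')(1−w²)`,
`w = u + vu'`. -/
theorem g2_poly {u v u' v' : ℝ} (hu : 0 ≤ u) (huv : u ≤ v) (hsum : u + v ≤ 1)
    (hu' : 0 ≤ u') (huv' : u' ≤ v') (hsum' : u' + v' ≤ 1) :
    (v * v' - (u + v * u')) * (1 - u ^ 2) * (1 - u' ^ 2) ≤
      (v - u) * (v' - u') * (1 - (u + v * u') ^ 2) := by
  have h1 := g2_identity u v u' v'
  have h2 := g2_rhs_nonneg hu huv hsum hu' huv' hsum'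
  linarith

/-- **Step 3, monotonicity**: for `0 ≤ u₁ ≤ u₂ ≤ 1` and `0 ≤ V ≤ 1 − u₁`,
`(V − u₂)(1 − u₁²) ≤ (V − u₁)(1 − u₂²)` — the difference is `(u₂ − u₁)[(1−u₁)(1−u₂) + u₁² + u₁u₂ + …] ≥ 0`. -/
theorem g2_mono {V u₁ u₂ : ℝ} (hu₁ : 0 ≤ u₁) (h12 : u₁ ≤ u₂) (hu₂ : u₂ ≤ 1)
    (hV1 : V ≤ 1 - u₁) :
    (V - u₂) * (1 - u₁ ^ 2) ≤ (V - u₁) * (1 - u₂ ^ 2) := by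
  have hd : 0 ≤ u₂ - u₁ := sub_nonneg.2 h12
  have hb : 0 ≤ 1 - V * (u₁ + u₂) + u₁ * u₂ := by
    have h3 : V * (u₁ + u₂) ≤ (1 - u₁) * (u₁ + u₂) :=
      mul_le_mul_of_nonneg_right hV1 (by linarith)
    have hu₁1 : u₁ ≤ 1 := le_trans h12 hu₂
    have hu₂0 : 0 ≤ u₂ := le_trans hu₁ h12
    nlinarith [mul_nonneg (sub_nonneg.2 hu₂) (sub_nonneg.2 hu₁1), mul_nonneg hu₁ hu₁,
      mul_nonneg hu₁ hu₂0]
  nlinarith [mul_nonneg hd hb]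

/-- **The core of G2 in the abstract variables**: with `0 ≤ u < v`, `u + v ≤ 1` (same primed),
`0 ≤ u'' ≤ 1` and `u + vu' ≤ u''`,
`vv'(vv' − u'')/(1 − u''²) ≤ [v(v−u)/(1−u²)]·[v'(v'−u')/(1−u'²)]`. -/
theorem g2_core {u v u' v' u'' : ℝ} (hu0 : 0 ≤ u) (huv : u < v) (hsum : u + v ≤ 1)
    (hu'0 : 0 ≤ u') (huv' : u' < v') (hsum' : u' + v' ≤ 1) (hu''0 : 0 ≤ u'') (hu''1 : u'' ≤ 1)
    (hwu'' : u + v * u' ≤ u'') :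
    v * v' * (v * v' - u'') / (1 - u'' ^ 2) ≤
      v * (v - u) / (1 - u ^ 2) * (v' * (v' - u') / (1 - u' ^ 2)) := by
  have hv0 : 0 ≤ v := le_trans hu0 huv.le
  have hv'0 : 0 ≤ v' := le_trans hu'0 huv'.le
  have hden : 0 < 1 - u ^ 2 := by nlinarith
  have hden' : 0 < 1 - u' ^ 2 := by nlinarith
  have hRHS : 0 ≤ v * (v - u) / (1 - u ^ 2) * (v' * (v' - u') / (1 - u' ^ 2)) :=
    mul_nonneg (div_nonneg (mul_nonneg hv0 (by linarith)) hden.le)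
      (div_nonneg (mul_nonneg hv'0 (by linarith)) hden'.le)
  by_cases hden'' : 1 - u'' ^ 2 = 0
  · rw [hden'', div_zero]
    exact hRHS
  · have hu''le : u'' ^ 2 ≤ 1 := (pow_le_one_iff_of_nonneg hu''0 (by norm_num : (2:ℕ) ≠ 0)).2 hu''1
    have hden''pos : 0 < 1 - u'' ^ 2 := lt_of_le_of_ne (by linarith) (Ne.symm hden'')
    have hw0 : 0 ≤ u + v * u' := add_nonneg hu0 (mul_nonneg hv0 hu'0)
    have hw1 : u + v * u' ≤ 1 - v * v' := by
      have h1 : v * u' ≤ v * (1 - v') := mul_le_mul_of_nonneg_left (by linarith) hv0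
      nlinarith
    have hmono := g2_mono (V := v * v') hw0 hwu'' hu''1 (by linarith)
    have hpoly := g2_poly hu0 huv.le hsum hu'0 huv'.le hsum'
    have hvv'0 : 0 ≤ v * v' := mul_nonneg hv0 hv'0
    have hw2 : 0 < 1 - (u + v * u') ^ 2 := by
      by_cases hvv : v * v' = 0
      · -- then `v = 0` or `v' = 0`, impossible with `u < v`, `u' < v'`, `0 ≤ u, u'`
        exfalso
        rcases mul_eq_zero.1 hvv with h | h <;> linarith
      · have hpos : 0 < v * v' := lt_of_le_of_ne hvv'0 (Ne.symm hvv)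
        nlinarith [mul_nonneg hw0 hw0]
    have step3 : v * v' * (v * v' - u'') / (1 - u'' ^ 2) ≤
        v * v' * (v * v' - (u + v * u')) / (1 - (u + v * u') ^ 2) := by
      rw [div_le_div_iff₀ hden''pos hw2]
      nlinarith [mul_le_mul_of_nonneg_left hmono hvv'0]
    have step4 : v * v' * (v * v' - (u + v * u')) / (1 - (u + v * u') ^ 2) ≤
        v * (v - u) / (1 - u ^ 2) * (v' * (v' - u') / (1 - u' ^ 2)) := by
      rw [div_mul_div_comm, div_le_div_iff₀ hw2 (mul_pos hden hden')]
      nlinarith [mul_le_mul_of_nonneg_left hpoly hvv'0]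
    exact le_trans step3 step4

/-! ### The substitution `u = √((1−x)(1−y))`, `v = √(xy)` -/

/-- `u + v ≤ 1` (AM–GM): `2uv = 2√(x(1−y)·y(1−x)) ≤ x(1−y) + y(1−x)`. -/
theorem sqrt_add_sqrt_le_one {x y : ℝ} (hx0 : 0 ≤ x) (hx1 : x ≤ 1) (hy0 : 0 ≤ y) (hy1 : y ≤ 1) :
    Real.sqrt ((1 - x) * (1 - y)) + Real.sqrt (x * y) ≤ 1 := by
  have hu := Real.sqrt_nonneg ((1 - x) * (1 - y))
  have hv := Real.sqrt_nonneg (x * y)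
  have hu2 : Real.sqrt ((1 - x) * (1 - y)) ^ 2 = (1 - x) * (1 - y) :=
    Real.sq_sqrt (mul_nonneg (by linarith) (by linarith))
  have hv2 : Real.sqrt (x * y) ^ 2 = x * y := Real.sq_sqrt (mul_nonneg hx0 hy0)
  have hprod : Real.sqrt ((1 - x) * (1 - y)) * Real.sqrt (x * y) ≤ (x * (1 - y) + y * (1 - x)) / 2 := by
    have hab : 0 ≤ x * (1 - y) := mul_nonneg hx0 (by linarith)
    have hba : 0 ≤ y * (1 - x) := mul_nonneg hy0 (by linarith)
    have hsq : (Real.sqrt ((1 - x) * (1 - y)) * Real.sqrt (x * y)) ^ 2 ≤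
        ((x * (1 - y) + y * (1 - x)) / 2) ^ 2 := by
      rw [mul_pow, hu2, hv2]
      nlinarith [sq_nonneg (x * (1 - y) - y * (1 - x))]
    have h0 : 0 ≤ (x * (1 - y) + y * (1 - x)) / 2 := by linarith
    exact (pow_le_pow_iff_left₀ (mul_nonneg hu hv) h0 (by norm_num : (2:ℕ) ≠ 0)).1 hsq
  nlinarith [sq_nonneg (Real.sqrt ((1 - x) * (1 - y)) + Real.sqrt (x * y) - 1)]

/-- `Φ(x, y) = v(v − u)/(1 − u²)` with `u = √((1−x)(1−y))`, `v = √(xy)`. -/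
theorem c028Phi_eq {x y : ℝ} (hx0 : 0 ≤ x) (hx1 : x ≤ 1) (hy0 : 0 ≤ y) (hy1 : y ≤ 1) :
    c028Phi x y = Real.sqrt (x * y) * (Real.sqrt (x * y) - Real.sqrt ((1 - x) * (1 - y))) /
      (1 - Real.sqrt ((1 - x) * (1 - y)) ^ 2) := by
  unfold c028Phi
  have hu2 : Real.sqrt ((1 - x) * (1 - y)) ^ 2 = (1 - x) * (1 - y) :=
    Real.sq_sqrt (mul_nonneg (by linarith) (by linarith))
  have hv2 : Real.sqrt (x * y) ^ 2 = x * y := Real.sq_sqrt (mul_nonneg hx0 hy0)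
  have harg : x * y * (1 - x) * (1 - y) = (x * y) * ((1 - x) * (1 - y)) := by ring
  have hR : Real.sqrt (x * y * (1 - x) * (1 - y)) = Real.sqrt (x * y) * Real.sqrt ((1 - x) * (1 - y)) := by
    rw [harg, Real.sqrt_mul (mul_nonneg hx0 hy0)]
  rw [hR, hu2]
  have hnum : x * y - Real.sqrt (x * y) * Real.sqrt ((1 - x) * (1 - y)) =
      Real.sqrt (x * y) * (Real.sqrt (x * y) - Real.sqrt ((1 - x) * (1 - y))) := by
    linear_combination (-1 : ℝ) * hv2
  have hden : x + y - x * y = 1 - (1 - x) * (1 - y) := by ring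
  rw [hnum, hden]

/-- **Step 1**: `x + y ≤ 1` gives `Φ(x, y) ≤ 0`. -/
theorem c028Phi_nonpos {x y : ℝ} (hx0 : 0 ≤ x) (hx1 : x ≤ 1) (hy0 : 0 ≤ y) (hy1 : y ≤ 1)
    (h : x + y ≤ 1) : c028Phi x y ≤ 0 := by
  rw [c028Phi_eq hx0 hx1 hy0 hy1]
  have hu := Real.sqrt_nonneg ((1 - x) * (1 - y))
  have hv := Real.sqrt_nonneg (x * y)
  have hu2 : Real.sqrt ((1 - x) * (1 - y)) ^ 2 = (1 - x) * (1 - y) :=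
    Real.sq_sqrt (mul_nonneg (by linarith) (by linarith))
  have hv2 : Real.sqrt (x * y) ^ 2 = x * y := Real.sq_sqrt (mul_nonneg hx0 hy0)
  have hvu : Real.sqrt (x * y) ≤ Real.sqrt ((1 - x) * (1 - y)) := by
    apply Real.sqrt_le_sqrt
    nlinarith
  apply div_nonpos_of_nonpos_of_nonneg
  · exact mul_nonpos_of_nonneg_of_nonpos hv (by linarith)
  · nlinarith

/-- **Step 2 (AM–GM)**: `(1−xx')(1−yy') ≥ (u + v u')²`. -/
theorem g2_amgm {x y x' y' : ℝ} (hx0 : 0 ≤ x) (hx1 : x ≤ 1) (hy0 : 0 ≤ y) (hy1 : y ≤ 1)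
    (hx'1 : x' ≤ 1) (hy'1 : y' ≤ 1) :
    (Real.sqrt ((1 - x) * (1 - y)) + Real.sqrt (x * y) * Real.sqrt ((1 - x') * (1 - y'))) ^ 2 ≤
      (1 - x * x') * (1 - y * y') := by
  set u := Real.sqrt ((1 - x) * (1 - y)) with hu
  set v := Real.sqrt (x * y) with hv
  set u' := Real.sqrt ((1 - x') * (1 - y')) with hu'
  have hu0 : 0 ≤ u := Real.sqrt_nonneg _
  have hv0 : 0 ≤ v := Real.sqrt_nonneg _
  have hu'0 : 0 ≤ u' := Real.sqrt_nonneg _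
  have hu2 : u ^ 2 = (1 - x) * (1 - y) := Real.sq_sqrt (mul_nonneg (by linarith) (by linarith))
  have hv2 : v ^ 2 = x * y := Real.sq_sqrt (mul_nonneg hx0 hy0)
  have hu'2 : u' ^ 2 = (1 - x') * (1 - y') := Real.sq_sqrt (mul_nonneg (by linarith) (by linarith))
  -- the cross term: (1−x)y(1−y') + x(1−x')(1−y) ≥ 2 u v u'
  have hcross : 2 * (u * v * u') ≤ (1 - x) * y * (1 - y') + x * (1 - x') * (1 - y) := by
    have ha : 0 ≤ (1 - x) * y * (1 - y') := mul_nonneg (mul_nonneg (by linarith) hy0) (by linarith)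
    have hb : 0 ≤ x * (1 - x') * (1 - y) := mul_nonneg (mul_nonneg hx0 (by linarith)) (by linarith)
    have hsq : (u * v * u') ^ 2 = ((1 - x) * y * (1 - y')) * (x * (1 - x') * (1 - y)) := by
      rw [mul_pow, mul_pow, hu2, hv2, hu'2]
      ring
    have hprod0 : 0 ≤ u * v * u' := mul_nonneg (mul_nonneg hu0 hv0) hu'0
    have h2 : (u * v * u') ^ 2 ≤ (((1 - x) * y * (1 - y') + x * (1 - x') * (1 - y)) / 2) ^ 2 := by
      rw [hsq]
      nlinarith [sq_nonneg ((1 - x) * y * (1 - y') - x * (1 - x') * (1 - y))]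
    have h3 := (pow_le_pow_iff_left₀ hprod0 (by linarith) (by norm_num : (2:ℕ) ≠ 0)).1 h2
    linarith
  nlinarith [hcross, hu2, hv2, hu'2]

/-- **LEMMA G2** (mine-3, MINE3-GLUING §3): for `x, y, x', y' ∈ [0, 1]`,
`Φ(xx', yy') ≤ Φ⁺(x, y)·Φ⁺(x', y')`. -/
theorem c028Phi_mul_le {x y x' y' : ℝ} (hx0 : 0 ≤ x) (hx1 : x ≤ 1) (hy0 : 0 ≤ y) (hy1 : y ≤ 1)
    (hx'0 : 0 ≤ x') (hx'1 : x' ≤ 1) (hy'0 : 0 ≤ y') (hy'1 : y' ≤ 1) :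
    c028Phi (x * x') (y * y') ≤ max (c028Phi x y) 0 * max (c028Phi x' y') 0 := by
  have hxx'0 : 0 ≤ x * x' := mul_nonneg hx0 hx'0
  have hxx'1 : x * x' ≤ 1 := by nlinarith
  have hyy'0 : 0 ≤ y * y' := mul_nonneg hy0 hy'0
  have hyy'1 : y * y' ≤ 1 := by nlinarith
  have hR0 : 0 ≤ max (c028Phi x y) 0 := le_max_right _ _
  have hR0' : 0 ≤ max (c028Phi x' y') 0 := le_max_right _ _
  -- Step 1: a trivial factor
  by_cases hcase : x + y ≤ 1 ∨ x' + y' ≤ 1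
  · have hle : x * x' + y * y' ≤ 1 := by
      rcases hcase with h | h
      · nlinarith [mul_nonneg hx0 (sub_nonneg.2 hx'1), mul_nonneg hy0 (sub_nonneg.2 hy'1)]
      · nlinarith [mul_nonneg hx'0 (sub_nonneg.2 hx1), mul_nonneg hy'0 (sub_nonneg.2 hy1)]
    exact le_trans (c028Phi_nonpos hxx'0 hxx'1 hyy'0 hyy'1 hle) (mul_nonneg hR0 hR0')
  · have hxy : 1 < x + y := not_le.1 fun h => hcase (Or.inl h)
    have hxy' : 1 < x' + y' := not_le.1 fun h => hcase (Or.inr h)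
    -- the substitution
    set u := Real.sqrt ((1 - x) * (1 - y)) with hu
    set v := Real.sqrt (x * y) with hv
    set u' := Real.sqrt ((1 - x') * (1 - y')) with hu'
    set v' := Real.sqrt (x' * y') with hv'
    set u'' := Real.sqrt ((1 - x * x') * (1 - y * y')) with hu''
    have hu0 : 0 ≤ u := Real.sqrt_nonneg _
    have hv0 : 0 ≤ v := Real.sqrt_nonneg _
    have hu'0 : 0 ≤ u' := Real.sqrt_nonneg _
    have hv'0 : 0 ≤ v' := Real.sqrt_nonneg _
    have hu''0 : 0 ≤ u'' := Real.sqrt_nonneg _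
    have hu2 : u ^ 2 = (1 - x) * (1 - y) := Real.sq_sqrt (mul_nonneg (by linarith) (by linarith))
    have hv2 : v ^ 2 = x * y := Real.sq_sqrt (mul_nonneg hx0 hy0)
    have hu'2 : u' ^ 2 = (1 - x') * (1 - y') := Real.sq_sqrt (mul_nonneg (by linarith) (by linarith))
    have hv'2 : v' ^ 2 = x' * y' := Real.sq_sqrt (mul_nonneg hx'0 hy'0)
    have hu''2 : u'' ^ 2 = (1 - x * x') * (1 - y * y') :=
      Real.sq_sqrt (mul_nonneg (by linarith) (by linarith))
    have hsum : u + v ≤ 1 := sqrt_add_sqrt_le_one hx0 hx1 hy0 hy1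
    have hsum' : u' + v' ≤ 1 := sqrt_add_sqrt_le_one hx'0 hx'1 hy'0 hy'1
    have huv : u < v := by
      rw [hu, hv]
      apply Real.sqrt_lt_sqrt (mul_nonneg (by linarith) (by linarith))
      nlinarith
    have huv' : u' < v' := by
      rw [hu', hv']
      apply Real.sqrt_lt_sqrt (mul_nonneg (by linarith) (by linarith))
      nlinarith
    have hvv'' : Real.sqrt (x * x' * (y * y')) = v * v' := by
      have harg : x * x' * (y * y') = (x * y) * (x' * y') := by ring
      rw [harg, Real.sqrt_mul (mul_nonneg hx0 hy0)]
    -- the three Φ's in the substitution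
    have hΦ : c028Phi x y = v * (v - u) / (1 - u ^ 2) := c028Phi_eq hx0 hx1 hy0 hy1
    have hΦ' : c028Phi x' y' = v' * (v' - u') / (1 - u' ^ 2) := c028Phi_eq hx'0 hx'1 hy'0 hy'1
    have hΦ'' : c028Phi (x * x') (y * y') = v * v' * (v * v' - u'') / (1 - u'' ^ 2) := by
      rw [c028Phi_eq hxx'0 hxx'1 hyy'0 hyy'1, hvv'']
    have hden : 0 < 1 - u ^ 2 := by rw [hu2]; nlinarith
    have hden' : 0 < 1 - u' ^ 2 := by rw [hu'2]; nlinarith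
    have hΦpos : 0 < c028Phi x y := by
      rw [hΦ]
      apply div_pos _ hden
      exact mul_pos (lt_of_le_of_lt hu0 huv) (by linarith)
    have hΦpos' : 0 < c028Phi x' y' := by
      rw [hΦ']
      apply div_pos _ hden'
      exact mul_pos (lt_of_le_of_lt hu'0 huv') (by linarith)
    rw [max_eq_left hΦpos.le, max_eq_left hΦpos'.le, hΦ'', hΦ, hΦ']
    have hu''le : u'' ^ 2 ≤ 1 := by
      rw [hu''2]
      exact mul_le_one₀ (by linarith) (by linarith) (by linarith)
    have hu''1 : u'' ≤ 1 := (pow_le_one_iff_of_nonneg hu''0 (by norm_num : (2:ℕ) ≠ 0)).1 hu''le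
    have hwu'' : u + v * u' ≤ u'' := by
      have h := g2_amgm hx0 hx1 hy0 hy1 hx'1 hy'1
      rw [← hu''2] at h
      exact (pow_le_pow_iff_left₀ (add_nonneg hu0 (mul_nonneg hv0 hu'0)) hu''0
        (by norm_num : (2:ℕ) ≠ 0)).1 h
    exact g2_core hu0 huv hsum hu'0 huv' hsum' hu''0 hu''1 hwu''

end Core

end PercRepro
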